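import Summits.BirchSwinnertonDyer.BirchSwinnertonDyer.Theorems.KolyvaginDepthDoorMSymbolCert709a1Odd
import Summits.BirchSwinnertonDyer.BirchSwinnertonDyer.Theorems.KolyvaginDepthDoorMSymbolCert389a1Twist
import Summits.BirchSwinnertonDyer.BirchSwinnertonDyer.Theorems.KolyvaginDepthDoorDepthTableRankTwo709a1TwistBSDQuotient
import Summits.BirchSwinnertonDyer.BirchSwinnertonDyer.Theorems.KatoDescentTamePotSupersingularTameUpperUnitTwistRecordToolsConductor
import Literature.NumberTheory.EllipticCurves.CuspFormTwistRatPlusSymbolOdd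
import Literature.NumberTheory.EllipticCurves.QuadraticTwistKroneckerLFunctionProofs
import Literature.NumberTheory.QuadraticFields.JacobiCharacterPrimitiveProofs
import Literature.NumberTheory.EllipticCurves.LFunctionSmulProofs
import Literature.NumberTheory.EllipticCurves.ModularityVersionApProofs
import HarnessLib

/-!
# Route `KolyvaginDepthDoor`, crux `KolyvaginDepthSupplyKN` (stmt-BirchSwinnertonDyer-22820) —
# DEPTH TABLE v27, TWIST SIDE of row `709a1` @ `(5, −7)`: the plus symbols of the newform of
# `T₀ = 709a1 ⊗ χ₋₇` (Cremona `34741 = 7²·709`) from the CERTIFIED minus M-symbol of `709a1`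

Helper file of the lead prover of line `levelone` (kdd-p1 g31; `--supports stmt-BirchSwinnertonDyer-22820
--as helper`); it closes nothing and BSD is NOT proved by it. The file is the row-`709a1` sibling of
`…MSymbolCert389a1Twist` (same argument, other numerals):
* `conductorNorm_T0`: `N_{T₀} = 34741 = 7²·709` (kernel: Tate exponents `f₇ = 2`, `f_709 = 1`);
* `LFunction_T0`: `aₙ(T₀) = (n/7) aₙ(709a1)`, hence `newform_T0_eq_charTwist`: the newform of `T₀` at level
  `34741` is `charTwist 34741 … (jacobiChar 7) f₀` for the newform `f₀` of `709a1`;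
* `exists_ratMinusSymbol_const`: `[y]⁻_{f₀} ∈ K₀ ℤ` and `[a/n]⁻_{f₀} = K₀ · S⁻(a/n)` (certified odd eigenvector
  `…MSymbolCert709a1Odd`, from `IsNewformOf` only);
* `exists_const_T0`: ONE rational `C` with `[r]⁺_g ∈ C ℤ` for all `r` and `[a/71]⁺_g = C · sigmaT a`
  (`0 < a < 71`), `sigmaT a = ∑_{u=1}^{6} (u/7) S⁻((7a + 71u)/497)` (Mazur–Tate–Teitelbaum §I.8 twist formula,
  `exists_rat_forall_ratPlusSymbol_charTwist_eq_of_odd`).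
Modularity of `709a1` enters as the row's hypothesis `exists_isNewformOf` (`hnf`).

References: [MazurTateTeitelbaum1986Invent] §I.8; [Shimura1971] Prop. 3.64; [CremonaAlgorithms1997] §2.8,
Table 1 (709a1); [SilvermanAEC2009] App. C §16 (conductor).
-/

set_option linter.dupNamespace false

noncomputable section

open scoped MatrixGroups ModularForm
open CongruenceSubgroup
open Literature.NumberTheory.EllipticCurves Literature.NumberTheory.EllipticCurves.ModularForms
open Literature.NumberTheory.QuadraticFields
open Summit.BirchSwinnertonDyer.BirchSwinnertonDyer.Rank2Observatory
open Summit.BirchSwinnertonDyer.BirchSwinnertonDyer.Theorems.TameUpperUnitTwistRecords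
  (conductorNorm_eq_of_exponents conductorExponent_natPlace_eq_two_of_five_le
    conductorExponent_natPlace_eq_one_of_dvd_of_not_dvd)
open Summit.BirchSwinnertonDyer.BirchSwinnertonDyer.Rank1Residual (IntModel.frobeniusTrace_eq)
open Summit.BirchSwinnertonDyer.BirchSwinnertonDyer.Theorems.KolyvaginDepthDoor.MSymbolCert.Cert389a1
  (jacobiChar_seven_odd jacobiChar_seven_isPrimitive jac7 jac7_eq)

namespace Summit.BirchSwinnertonDyer.BirchSwinnertonDyer.Theorems.KolyvaginDepthDoor.MSymbolCert.Cert709a1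

/-! ## §1 `T₀ = 34741 = 7²·709` and its conductor -/

/-- The minimal model `T₀` of `709a1^{(-7)}` (Cremona `34741 = 7²·709`). [cite: CremonaAlgorithms1997, Table 1 (709a1)] -/
abbrev T0 : WeierstrassCurve ℚ := (⟨0, 1, 1, -114, 130⟩ : WeierstrassCurve ℤ).map (Int.castRingHom ℚ)

/-- **`N(T₀) = 34741 = 7² · 709`** (kernel: `Δ(T₀) = 7⁶ · 709`, `7 ∣ c₄ = 5488` so `f₇ = 2`, `709 ∤ c₄` so
`f_709 = 1`; the tree's `conductorNorm_eq_of_exponents`). [cite: SilvermanAEC2009, App. C §16] -/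
theorem conductorNorm_T0 : haveI := C709a1.minTwist7_isElliptic; T0.conductorNorm ℤ = 34741 := by
  haveI := C709a1.minTwist7_isElliptic
  haveI := C709a1.minTwist7_isGloballyMinimal
  have hI := C709a1.minTwist7_intModel
  have h := conductorNorm_eq_of_exponents hI (G := [(7, 6), (709, 1)]) (by decide +kernel)
    (by intro qe hqe; simp only [List.mem_cons, List.not_mem_nil, or_false] at hqe
        rcases hqe with rfl | rfl <;> norm_num)
    [(7, 2), (709, 1)]
    (by intro qf hqf; simp only [List.mem_cons, List.not_mem_nil, or_false] at hqf
        rcases hqf with rfl | rfl <;> norm_num)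
    (by decide) (by decide)
    (by
      intro qf hqf
      simp only [List.mem_cons, List.not_mem_nil, or_false] at hqf
      rcases hqf with rfl | rfl
      · exact conductorExponent_natPlace_eq_two_of_five_le hI (by norm_num) (by norm_num) (n := 6) (by norm_num)
          (by decide +kernel) (by decide +kernel) (by norm_num) (by decide +kernel)
      · exact conductorExponent_natPlace_eq_one_of_dvd_of_not_dvd hI (by norm_num) (by decide +kernel) (by decide +kernel))
  rw [h]; norm_num

/-! ## §2 The Dirichlet coefficients of `T₀` -/

/-- **`aₙ(T₀) = (n/7) · aₙ(709a1)`** (`T₀ ≅ 709a1^{(-7)}`, `-7 ≡ 1 (mod 4)`, `709a1` good at `7`).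
[cite: SilvermanAEC2009, X.5 Cor. 5.4] -/
theorem LFunction_T0 (n : ℕ) :
    haveI := C709a1.minTwist7_isElliptic; haveI := isElliptic_c709a1;
    (T0.LFunction n : ℂ) = jacobiChar 7 n * ((((⟨0, -1, 1, -2, 0⟩ : WeierstrassCurve ℤ).map (Int.castRingHom ℚ))).LFunction n : ℂ) := by
  haveI := C709a1.minTwist7_isElliptic
  haveI := isElliptic_c709a1
  haveI := isGloballyMinimal_c709a1
  have hsmul := WeierstrassCurve.LFunction_smul T0 (⟨1, (2 : ℚ), (0 : ℚ), -((1 : ℚ) / 2)⟩ : WeierstrassCurve.VariableChange ℚ)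
  rw [C709a1.minTwist7_smul_eq] at hsmul
  have hgood : ∀ v : IsDedekindDomain.HeightOneSpectrum (NumberField.RingOfIntegers ℚ),
      ((Rat.HeightOneSpectrum.primesEquiv v : ℕ) : ℤ) ∣ (-7 : ℤ) → (((⟨0, -1, 1, -2, 0⟩ : WeierstrassCurve ℤ).map (Int.castRingHom ℚ))).HasGoodReductionAt v := by
    intro v hv
    by_contra hbad
    have hdvdN : (Rat.HeightOneSpectrum.primesEquiv v : ℕ) ∣ (((⟨0, -1, 1, -2, 0⟩ : WeierstrassCurve ℤ).map (Int.castRingHom ℚ))).conductorNorm ℤ :=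
      ((((⟨0, -1, 1, -2, 0⟩ : WeierstrassCurve ℤ).map (Int.castRingHom ℚ))).dvd_conductorNorm_iff v).mpr hbad
    rw [C709a1.conductorNorm_eq] at hdvdN
    have h7 : (Rat.HeightOneSpectrum.primesEquiv v : ℕ) ∣ 7 := by
      have : ((Rat.HeightOneSpectrum.primesEquiv v : ℕ) : ℤ) ∣ ((7 : ℕ) : ℤ) := by simpa using hv
      exact_mod_cast this
    have hp := (Rat.HeightOneSpectrum.primesEquiv v).2
    have h7' : (Rat.HeightOneSpectrum.primesEquiv v : ℕ) = 7 :=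
      (Nat.prime_dvd_prime_iff_eq hp (by norm_num)).mp h7
    rw [h7'] at hdvdN
    norm_num at hdvdN
  have hsq : Squarefree (-7 : ℤ) := by
    rw [← Int.squarefree_natAbs]
    exact (Nat.prime_iff.mp (by norm_num : Nat.Prime 7)).squarefree
  have htw := (((⟨0, -1, 1, -2, 0⟩ : WeierstrassCurve ℤ).map (Int.castRingHom ℚ))).LFunction_quadraticTwist_apply_of_emod_four_eq_one (D := -7) (by decide) hsq hgood n
  rw [show (((-7 : ℤ) : ℚ)) = (-7 : ℚ) by norm_num] at htw
  rw [← hsmul, htw, jacobiChar_natCast]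
  push_cast
  rfl

/-! ## §3 The newform of `T₀` is the twist of the newform of `709a1` -/

/-- `709 ∣ 34741`. [folklore] -/
theorem dvd_34741 : 709 ∣ 34741 := by norm_num

/-- `7² ∣ 34741`. [folklore] -/
theorem sq_dvd_34741 : 7 ^ 2 ∣ 34741 := by norm_num

/-- **The newform of `T₀` at level `34741` is `f₀ ⊗ χ₋₇`** for the newform `f₀` of `709a1` (q-expansion principle).
[cite: Shimura1971, Prop. 3.64] -/
theorem newform_T0_eq_charTwist (f₀ : CuspForm (Gamma0 709) 2)
    (hf₀ : haveI := isElliptic_c709a1; IsNewformOf (((⟨0, -1, 1, -2, 0⟩ : WeierstrassCurve ℤ).map (Int.castRingHom ℚ))) f₀)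
    (g : CuspForm (Gamma0 34741) 2) (hg : haveI := C709a1.minTwist7_isElliptic; IsNewformOf T0 g) :
    g = charTwist 34741 dvd_34741 sq_dvd_34741 (isQuadratic_jacobiChar (q := 7)) f₀ := by
  haveI := isElliptic_c709a1
  refine eq_of_forall_cuspCoeff_eq_gamma0 fun n => ?_
  rw [cuspCoeff_charTwist _ _ _ _ jacobiChar_seven_isPrimitive, hf₀.2 n, hg.2 n, LFunction_T0]

/-! ## §4 The minus symbols of the newform of `709a1` (from the certified odd eigenvector) -/

/-- `T₃ f₀ = -1 f₀` for the newform of `709a1` at level `709`. [cite: CremonaAlgorithms1997, Table 1 (709a1)] -/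
theorem heckeT3_of_isNewformOf (f₀ : CuspForm (Gamma0 709) 2)
    (hf₀ : haveI := isElliptic_c709a1; IsNewformOf (((⟨0, -1, 1, -2, 0⟩ : WeierstrassCurve ℤ).map (Int.castRingHom ℚ))) f₀) :
    heckeTnGamma0 709 2 3 f₀ = ((-1 : ℝ) : ℂ) • f₀ := by
  haveI : Fact (Nat.Prime 3) := ⟨by norm_num⟩
  haveI : NeZero (3 : ℕ) := ⟨by norm_num⟩
  haveI := isElliptic_c709a1
  haveI := isGloballyMinimal_c709a1
  have hgood : (((⟨0, -1, 1, -2, 0⟩ : WeierstrassCurve ℤ).map (Int.castRingHom ℚ))).HasGoodReductionAtPrime 3 :=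
    (goodOrdinary_of_intModel_certificate C709a1.intModel 3 (by decide +kernel) (n := 5) C709a1.AtThree.card_3
      (by decide +kernel)).1
  have hc : cuspCoeff f₀ 3 = ((((⟨0, -1, 1, -2, 0⟩ : WeierstrassCurve ℤ).map (Int.castRingHom ℚ))).frobeniusTrace 3 : ℂ) :=
    cuspCoeff_eq_frobeniusTrace_of_isNewformOf_holds hf₀ hgood
  have htr : (((⟨0, -1, 1, -2, 0⟩ : WeierstrassCurve ℤ).map (Int.castRingHom ℚ))).frobeniusTrace 3 = -1 := by
    rw [IntModel.frobeniusTrace_eq C709a1.intModel C709a1.AtThree.card_3]; norm_num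
  rw [heckeTnGamma0_prime 709 2 3 (by norm_num), IsNewform0.heckeT_eq_coeff_smul hf₀.1 (by norm_num),
    show (PowerSeries.coeff 3) (UpperHalfPlane.qExpansion 1 ⇑f₀) = cuspCoeff f₀ 3 from rfl, hc, htr]
  push_cast
  rfl



/-- **`[y]⁻_{f₀} ∈ K₀ ℤ` and `[a/n]⁻_{f₀} = K₀ · S⁻(a/n)`** for the newform `f₀` of `709a1`, ONE rational `K₀`:
the certified odd eigenvector (`certOdd709a1_check`, `poolOdd_holds`, kit 5), periodicity for integral `y`.
[cite: MazurTateTeitelbaum1986Invent, §I.8] -/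
theorem exists_ratMinusSymbol_const (f₀ : CuspForm (Gamma0 709) 2)
    (hf₀ : haveI := isElliptic_c709a1; IsNewformOf (((⟨0, -1, 1, -2, 0⟩ : WeierstrassCurve ℤ).map (Int.castRingHom ℚ))) f₀) :
    ∃ K₀ : ℚ, (∀ y : ℚ, ∃ k : ℤ, ratMinusSymbol f₀ y = K₀ * k) ∧
      ∀ (a w : ℤ) (n : ℕ), 0 < n → a * w % n = 1 → ∀ fuel : ℕ, n < fuel →
        ratMinusSymbol f₀ ((a : ℚ) / n) = K₀ * chainSum 709 phim709a1 fuel n w := by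
  haveI := isElliptic_c709a1
  have hreal : ∀ m, (cuspCoeff f₀ m).im = 0 := cuspCoeff_im_eq_zero_of_coeffField_eq_bot hf₀.coeffField_eq_bot
  have hF : ∀ k < 2840, eval (Ψm f₀) (genOdd709a1 k) = 0 := fun k _ =>
    poolOdd_holds f₀ hreal (heckeT3_of_isNewformOf f₀ hf₀) k
  obtain ⟨t, ht⟩ := exists_eq_smul_of_checkF certOdd709a1 genOdd709a1 2840 710 phim709a1 certOdd709a1_check (Ψm f₀) hF
  obtain ⟨g, ε, hg, hε, hval⟩ :=
    exists_ratMinusSymbol_eq f₀ hf₀.1 hf₀.coeffField_eq_bot (fun i hi => ht i (by omega))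
  refine ⟨(ε : ℚ) / (2 * g), fun y => ?_, fun a w n hn hw fuel hfuel => by rw [hval a w n hn hw fuel hfuel]; ring⟩
  by_cases hden : y.den = 1
  · refine ⟨0, ?_⟩
    have hy : y = ((y.num : ℚ)) := by
      conv_lhs => rw [← Rat.num_div_den y]
      rw [hden]; simp
    rw [hy, show ((y.num : ℚ)) = 0 + (y.num : ℚ) by ring, ratMinusSymbol_add_intCast, ratMinusSymbol_zero]
    simp
  · have hcop : IsCoprime y.num (y.den : ℤ) := by
      rw [Int.isCoprime_iff_gcd_eq_one]
      exact y.reduced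
    obtain ⟨u, v, huv⟩ := hcop
    have hden1 : (1 : ℤ) < y.den := by
      have := y.den_pos
      omega
    have hw : y.num * u % (y.den : ℤ) = 1 := by
      have : y.num * u = 1 + (y.den : ℤ) * (-v) := by linarith
      rw [this, Int.add_mul_emod_self_left, Int.emod_eq_of_lt (by norm_num) hden1]
    refine ⟨chainSum 709 phim709a1 (y.den + 1) y.den u, ?_⟩
    have h := hval y.num u y.den y.den_pos hw (y.den + 1) (by omega)
    rw [Rat.num_div_den] at h
    rw [h]
    ring

/-! ## §5 The plus symbols of the newform of `T₀` -/

/-- The Bezout witness `(7a + 71u)^{419} mod 497` (an inverse of `7a + 71u` modulo `497 = 7·71`). [folklore] -/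
def bezT (a u : ℕ) : ℤ := (((7 * a + 71 * u) ^ 419 % 497 : ℕ) : ℤ)

/-- The kernel's twisted minus sum at `r = a/71`: `∑_{u=1}^{6} (u/7) · S⁻((7a + 71u)/497)`.
[cite: MazurTateTeitelbaum1986Invent, §I.8] -/
def sigmaT (a : ℕ) : ℤ :=
  ∑ u : ZMod 7, (if u.val = 0 then 0 else jac7 u.val * chainSum 709 phim709a1 498 497 (bezT a u.val))

/-- Bezout data at `497 = 7 · 71` (decide). [folklore] -/
theorem bezout_497 : ∀ a < 71, Nat.Coprime a 71 → ∀ u < 7, u ≠ 0 →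
    (((7 * a + 71 * u : ℕ) : ℤ) * bezT a u) % 497 = 1 := by
  unfold bezT
  decide +kernel

/-- A modular parametrisation newform of `709a1` at level `709` exists, granted modularity BY NAME
(`exists_isNewformOf`; `N(709a1) = 709`). [cite: BreuilConradDiamondTaylor2001, Thm. A] -/
theorem exists_newform_709a1 (hnf : exists_isNewformOf) :
    haveI := isElliptic_c709a1;
    ∃ f₀ : CuspForm (Gamma0 709) 2, IsNewformOf (((⟨0, -1, 1, -2, 0⟩ : WeierstrassCurve ℤ).map (Int.castRingHom ℚ))) f₀ := by
  haveI := isElliptic_c709a1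
  haveI : NeZero ((((⟨0, -1, 1, -2, 0⟩ : WeierstrassCurve ℤ).map (Int.castRingHom ℚ))).conductorNorm ℤ) := neZero_conductorNorm_of_isElliptic _
  suffices h : ∀ L : ℕ, L = (((⟨0, -1, 1, -2, 0⟩ : WeierstrassCurve ℤ).map (Int.castRingHom ℚ))).conductorNorm ℤ → ∀ [NeZero L],
      ∃ f₀ : CuspForm (Gamma0 L) 2, IsNewformOf (((⟨0, -1, 1, -2, 0⟩ : WeierstrassCurve ℤ).map (Int.castRingHom ℚ))) f₀ from
    h 709 C709a1.conductorNorm_eq.symm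
  intro L hL _
  subst hL
  exact hnf _

/-- **The plus symbols of the newform `g` of `T₀` at level `34741`**: ONE rational `C` with `[r]⁺_g ∈ C ℤ` for
all `r` and `[a/71]⁺_g = C · sigmaT a` for `0 < a < 71` — the twist formula
(`exists_rat_forall_ratPlusSymbol_charTwist_eq_of_odd`) and the certified minus symbols of `f₀`
(`exists_ratMinusSymbol_const`); modularity of `709a1` by name (`hnf`).
[cite: MazurTateTeitelbaum1986Invent, §I.8] [cite: Shimura1971, Prop. 3.64] -/
theorem exists_const_T0 (hnf : exists_isNewformOf) (g : CuspForm (Gamma0 34741) 2)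
    (hg : haveI := C709a1.minTwist7_isElliptic; IsNewformOf T0 g) :
    ∃ C : ℚ, (∀ r : ℚ, ∃ m : ℤ, ratPlusSymbol g r = C * m) ∧
      ∀ a < 71, Nat.Coprime a 71 → ratPlusSymbol g ((a : ℚ) / 71) = C * sigmaT a := by
  haveI := C709a1.minTwist7_isElliptic
  haveI := isElliptic_c709a1
  obtain ⟨f₀, hf₀⟩ := exists_newform_709a1 hnf
  have hgF := newform_T0_eq_charTwist f₀ hf₀ g hg
  set F := charTwist 34741 dvd_34741 sq_dvd_34741 (isQuadratic_jacobiChar (q := 7)) f₀ with hFdef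
  have hF : IsNewform0 F := hgF ▸ hg.1
  have hQF : coeffField F = ⊥ := hgF ▸ hg.coeffField_eq_bot
  obtain ⟨c, hc, -⟩ := exists_rat_forall_ratPlusSymbol_charTwist_eq_of_odd 34741 dvd_34741 sq_dvd_34741
    (isQuadratic_jacobiChar (q := 7)) jacobiChar_seven_odd jacobiChar_seven_isPrimitive hf₀.1
    hf₀.coeffField_eq_bot hF hQF (fun u : ZMod 7 => jacobiSym (u.val : ℤ) 7) (fun u => jacobiChar_apply u)
  obtain ⟨K₀, hK₀all, hK₀val⟩ := exists_ratMinusSymbol_const f₀ hf₀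
  refine ⟨c * K₀, fun r => ?_, fun a ha hac => ?_⟩
  · choose k hk using hK₀all
    refine ⟨∑ u : ZMod 7, jacobiSym (u.val : ℤ) 7 * k (r + twistShift u), ?_⟩
    rw [hgF, hc r]
    push_cast
    rw [Finset.mul_sum, Finset.mul_sum]
    refine Finset.sum_congr rfl fun u _ => ?_
    rw [hk (r + twistShift u)]
    ring
  · rw [hgF, hc ((a : ℚ) / 71)]
    have hterm : ∀ u : ZMod 7, (jacobiSym (u.val : ℤ) 7 : ℚ) * ratMinusSymbol f₀ ((a : ℚ) / 71 + twistShift u) =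
        K₀ * ((if u.val = 0 then 0 else jac7 u.val * chainSum 709 phim709a1 498 497 (bezT a u.val) : ℤ) : ℚ) := by
      intro u
      have hu7 : u.val < 7 := ZMod.val_lt u
      by_cases hu : u.val = 0
      · rw [hu, if_pos rfl]
        simp [jacobiSym.zero_left]
      · rw [if_neg hu, jac7_eq u.val hu7]
        have hbez := bezout_497 a ha hac u.val hu7 hu
        have hval := hK₀val ((7 * a + 71 * u.val : ℕ) : ℤ) (bezT a u.val) 497 (by norm_num) hbez 498 (by norm_num)
        have hr : (a : ℚ) / 71 + twistShift u = (((7 * a + 71 * u.val : ℕ) : ℤ) : ℚ) / (497 : ℕ) := by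
          rw [twistShift]
          push_cast
          field_simp
          ring
        rw [hr, hval]
        push_cast
        ring
    rw [Finset.sum_congr rfl fun u _ => hterm u, ← Finset.mul_sum, sigmaT, Int.cast_sum]
    ring

end Summit.BirchSwinnertonDyer.BirchSwinnertonDyer.Theorems.KolyvaginDepthDoor.MSymbolCert.Cert709a1

end
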